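import Mathlib.Analysis.InnerProductSpace.Adjoint

/-!
# `Balaban1983to89.B6CovarianceOperator` — T. Bałaban, *Propagators and renormalization transformations for lattice gauge
# theories. II*, Commun. Math. Phys. **96** (1984) 223–250 [Balaban1984PropagatorsII]: the generic finite-dimensional facts
# behind *"G = Δ_a⁻¹"* (2.22) and *"a covariance of the (last) Gaussian integral(s)"* ((2.106)–(2.110) p. 242, (2.115) p. 243,
# p. 246) — the inverse of a positive-definite operator and the COVARIANCE OPERATOR `C = ι(ι*Sι)⁻¹ι*` of a form on a subspace

statement-level skeleton of published theorems with citation tags; proofs where landed; nothing here is a claim about the Yang–Mills mass gap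

CITATION HEADER (lean-in-tree rule).  WHAT IS REPRODUCED: the operator-theoretic content of the phrases *"the operator Δ_a is
bounded from below by a positive constant, hence … G = Δ_a⁻¹"* (p. 226), *"Let us denote by C^{(j)}_Λ a covariance of the last
Gaussian integrals"* (p. 242), *"Let us denote a covariance of this Gaussian integral by G̃_j"* (p. 243) and *"the operators
C̃^{(j)}_Λ are bounded from above by γ₀″⁻¹I"* (p. 246) in the finite-dimensional `ℓ²` model of lit-balaban rows B6.Eq2.110 /
B6.Eq2.119 / B6.Eq2.129 / B6.Eq2.131: (i) a positive-definite operator on a finite-dimensional real inner-product space is a unit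
and `Ring.inverse` is its two-sided, symmetric, positive inverse; (ii) for an operator `S` positive definite on a subspace `K`,
the operator `covOp K S = ι(ι*Sι)⁻¹ι*` (`ι` the inclusion, `ι*` its adjoint, `ι*Sι` the compression) ranges in `K`, is symmetric,
inverts the form on `K` (`⟨k, S(Cs)⟩ = ⟨k, s⟩`, the hypothesis shape `hsol` of `…B6Eq295.eq2115`), is positive on `K`, and is the
UNIQUE operator with these properties (`cov_unique`) — so that *"a covariance"* is a definite operator.  Used by the companion
`…B6SectCOperators` (same seat) to DEFINE `G`, `C^{(j)}_Λ`, `G̃_j`, `C̃^{(j)}_Λ` of Sect. C.  PHASE-2 seat p22 (gen 8); owner r03,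
referee ref-4.  Mathlib only (the Gaussian-integral side of the same facts is `…B6Eq226CovarianceMoments.covariance_exists`).
HONEST SCOPE: finite-dimensional linear algebra at [folklore] level, cited to the sentences it serves; NOT summit progress.
Unit `lit-balaban-p22` (gen 8), HOME `run/shared/lean/pub/lit-balaban/`, 2026-08-21.
-/

noncomputable section

open scoped InnerProductSpace

namespace Literature.MathematicalPhysics.QuantumFieldTheory.Balaban1983to89.B6CovarianceOperator

/-! ## §1  Generic finite-dimensional facts: inverses of positive operators; the covariance operator of a form on a subspace -/

section Generic

variable {V : Type*} [NormedAddCommGroup V] [InnerProductSpace ℝ V] [FiniteDimensional ℝ V]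

/-- A positive-definite operator on a finite-dimensional space is a unit (*"bounded from below by a positive constant, hence
… G = Δ_a⁻¹"*). [cite: Balaban1984PropagatorsII, (2.22) p.226] -/
theorem isUnit_of_posDef (S : V →ₗ[ℝ] V) (hpos : ∀ v : V, v ≠ 0 → 0 < ⟪v, S v⟫_ℝ) : IsUnit S := by
  rw [LinearMap.isUnit_iff_ker_eq_bot, LinearMap.ker_eq_bot']
  intro v hv
  by_contra hne
  have h := hpos v hne
  rw [hv, inner_zero_right] at h
  exact lt_irrefl _ h

/-- `Δ_a G = I` for `G = Ring.inverse Δ_a`, `Δ_a` positive definite. [cite: Balaban1984PropagatorsII, (2.22) p.226] -/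
theorem apply_inverse (S : V →ₗ[ℝ] V) (hpos : ∀ v : V, v ≠ 0 → 0 < ⟪v, S v⟫_ℝ) (v : V) : S (Ring.inverse S v) = v := by
  have h := Ring.mul_inverse_cancel S (isUnit_of_posDef S hpos)
  simpa using LinearMap.congr_fun h v

/-- `G Δ_a = I` for `G = Ring.inverse Δ_a`, `Δ_a` positive definite. [cite: Balaban1984PropagatorsII, (2.22) p.226] -/
theorem inverse_apply (S : V →ₗ[ℝ] V) (hpos : ∀ v : V, v ≠ 0 → 0 < ⟪v, S v⟫_ℝ) (v : V) : Ring.inverse S (S v) = v := by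
  have h := Ring.inverse_mul_cancel S (isUnit_of_posDef S hpos)
  simpa using LinearMap.congr_fun h v

/-- `Δ_a ∘ G = id` (operator form). [cite: Balaban1984PropagatorsII, (2.22) p.226] -/
theorem comp_inverse (S : V →ₗ[ℝ] V) (hpos : ∀ v : V, v ≠ 0 → 0 < ⟪v, S v⟫_ℝ) : S ∘ₗ Ring.inverse S = LinearMap.id :=
  LinearMap.ext (apply_inverse S hpos)

/-- `G ∘ Δ_a = id` (operator form). [cite: Balaban1984PropagatorsII, (2.22) p.226] -/
theorem inverse_comp (S : V →ₗ[ℝ] V) (hpos : ∀ v : V, v ≠ 0 → 0 < ⟪v, S v⟫_ℝ) : Ring.inverse S ∘ₗ S = LinearMap.id :=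
  LinearMap.ext (inverse_apply S hpos)

/-- The inverse of a symmetric positive-definite operator is symmetric (*"G is positive"*, p. 228).
[cite: Balaban1984PropagatorsII, (2.22) p.226 + p.228] -/
theorem inverse_symm (S : V →ₗ[ℝ] V) (hS : ∀ x y : V, ⟪S x, y⟫_ℝ = ⟪x, S y⟫_ℝ) (hpos : ∀ v : V, v ≠ 0 → 0 < ⟪v, S v⟫_ℝ)
    (x y : V) : ⟪Ring.inverse S x, y⟫_ℝ = ⟪x, Ring.inverse S y⟫_ℝ := by
  calc ⟪Ring.inverse S x, y⟫_ℝ = ⟪Ring.inverse S x, S (Ring.inverse S y)⟫_ℝ := by rw [apply_inverse S hpos]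
    _ = ⟪S (Ring.inverse S x), Ring.inverse S y⟫_ℝ := (hS _ _).symm
    _ = ⟪x, Ring.inverse S y⟫_ℝ := by rw [apply_inverse S hpos]

/-- The inverse of a positive-definite operator is positive definite (*"The operator G is positive"*, p. 228).
[cite: Balaban1984PropagatorsII, p.228] -/
theorem inverse_pos (S : V →ₗ[ℝ] V) (hpos : ∀ v : V, v ≠ 0 → 0 < ⟪v, S v⟫_ℝ) (x : V) (hx : x ≠ 0) :
    0 < ⟪x, Ring.inverse S x⟫_ℝ := by
  have hGx : Ring.inverse S x ≠ 0 := fun h => hx (by rw [← apply_inverse S hpos x, h, map_zero])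
  have h := hpos _ hGx
  rwa [apply_inverse S hpos, real_inner_comm] at h

omit [FiniteDimensional ℝ V] in
/-- A positive-definite form is non-negative. [cite: Balaban1984PropagatorsII, p.228] -/
theorem nonneg_of_posDef (S : V →ₗ[ℝ] V) (hpos : ∀ v : V, v ≠ 0 → 0 < ⟪v, S v⟫_ℝ) (v : V) : 0 ≤ ⟪v, S v⟫_ℝ := by
  by_cases hv : v = 0
  · rw [hv, inner_zero_left]
  · exact (hpos v hv).le

/-- The compression `ι*Sι` of an operator `S` to a subspace `K` (`ι` the inclusion, `ι*` its adjoint) — the operator of the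
constrained Gaussian `∫_K e^{−½⟨k,Sk⟩}(…)`. [cite: Balaban1984PropagatorsII, (2.110) p.242] -/
def compress (K : Submodule ℝ V) (S : V →ₗ[ℝ] V) : ↥K →ₗ[ℝ] ↥K :=
  LinearMap.adjoint K.subtype ∘ₗ S ∘ₗ K.subtype

/-- The `K`-valued factor `(ι*Sι)⁻¹ι*` of the covariance operator. [cite: Balaban1984PropagatorsII, (2.110) p.242] -/
def covOpT (K : Submodule ℝ V) (S : V →ₗ[ℝ] V) : V →ₗ[ℝ] ↥K :=
  Ring.inverse (compress K S) ∘ₗ LinearMap.adjoint K.subtype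

/-- **The covariance operator** `C = ι(ι*Sι)⁻¹ι*` of the Gaussian `∫_K e^{−½⟨k,Sk⟩}(…)dk` carried by the subspace `K` (*"a
covariance of the last Gaussian integrals"*, p. 242; *"a covariance of this Gaussian integral"*, p. 243): the operator on the
whole space which ranges in `K`, is symmetric, and inverts the form on `K`. [cite: Balaban1984PropagatorsII, (2.110) p.242 + (2.115) p.243] -/
def covOp (K : Submodule ℝ V) (S : V →ₗ[ℝ] V) : V →ₗ[ℝ] V :=
  K.subtype ∘ₗ covOpT K S

/-- Matrix elements of the compression: `⟨k, ι*Sι k′⟩_K = ⟨k, Sk′⟩`. [cite: Balaban1984PropagatorsII, (2.110) p.242] -/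
theorem inner_compress (K : Submodule ℝ V) (S : V →ₗ[ℝ] V) (k k' : ↥K) :
    ⟪k, compress K S k'⟫_ℝ = ⟪(k : V), S k'⟫_ℝ := by
  simp only [compress, LinearMap.coe_comp, Function.comp_apply, Submodule.coe_subtype]
  rw [LinearMap.adjoint_inner_right]
  rfl

/-- The compression of a symmetric operator is symmetric. [cite: Balaban1984PropagatorsII, (2.110) p.242] -/
theorem compress_symm (K : Submodule ℝ V) (S : V →ₗ[ℝ] V) (hS : ∀ x y : V, ⟪S x, y⟫_ℝ = ⟪x, S y⟫_ℝ) (k k' : ↥K) :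
    ⟪compress K S k, k'⟫_ℝ = ⟪k, compress K S k'⟫_ℝ := by
  rw [real_inner_comm, inner_compress, inner_compress, ← hS, real_inner_comm]

/-- The compression of an operator positive definite on `K` is positive definite. [cite: Balaban1984PropagatorsII, (2.110) p.242] -/
theorem compress_pos (K : Submodule ℝ V) (S : V →ₗ[ℝ] V) (hpos : ∀ k : ↥K, k ≠ 0 → 0 < ⟪(k : V), S k⟫_ℝ) (k : ↥K)
    (hk : k ≠ 0) : 0 < ⟪k, compress K S k⟫_ℝ := by
  rw [inner_compress]; exact hpos k hk

/-- `C s = ι(T_C s)`: the covariance factors through `K`. [cite: Balaban1984PropagatorsII, (2.110) p.242] -/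
theorem covOp_apply (K : Submodule ℝ V) (S : V →ₗ[ℝ] V) (v : V) : covOp K S v = K.subtype (covOpT K S v) := rfl

/-- The covariance ranges in `K`. [cite: Balaban1984PropagatorsII, (2.110) p.242] -/
theorem covOp_mem (K : Submodule ℝ V) (S : V →ₗ[ℝ] V) (v : V) : covOp K S v ∈ K := (covOpT K S v).2

/-- The covariance is symmetric. [cite: Balaban1984PropagatorsII, (2.110) p.242 + (2.115) p.243] -/
theorem covOp_symm (K : Submodule ℝ V) (S : V →ₗ[ℝ] V) (hS : ∀ x y : V, ⟪S x, y⟫_ℝ = ⟪x, S y⟫_ℝ)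
    (hpos : ∀ k : ↥K, k ≠ 0 → 0 < ⟪(k : V), S k⟫_ℝ) (x y : V) : ⟪covOp K S x, y⟫_ℝ = ⟪x, covOp K S y⟫_ℝ := by
  have h1 : ∀ (k : ↥K) (v : V), ⟪(K.subtype k : V), v⟫_ℝ = ⟪k, LinearMap.adjoint K.subtype v⟫_ℝ := fun k v => by
    rw [LinearMap.adjoint_inner_right]
  simp only [covOp, covOpT, LinearMap.coe_comp, Function.comp_apply]
  rw [h1, inverse_symm _ (compress_symm K S hS) (compress_pos K S hpos), ← real_inner_comm x, h1]
  exact real_inner_comm _ _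

/-- **The covariance inverts the form on `K`**: `⟨k, S(Cs)⟩ = ⟨k, s⟩` for `k ∈ K` — the hypothesis shape `hsol`/`hCsol`/`hCtsol`
of `…B6Eq295.eq2115` / `…B6Eq2112` / `…B6Repr2129`. [cite: Balaban1984PropagatorsII, (2.110) p.242 + (2.115) p.243] -/
theorem covOp_sol (K : Submodule ℝ V) (S : V →ₗ[ℝ] V) (hpos : ∀ k : ↥K, k ≠ 0 → 0 < ⟪(k : V), S k⟫_ℝ) (k : ↥K)
    (s : V) : ⟪(k : V), S (covOp K S s)⟫_ℝ = ⟪(k : V), s⟫_ℝ := by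
  have h1 : ⟪(k : V), S (covOp K S s)⟫_ℝ = ⟪k, compress K S (covOpT K S s)⟫_ℝ := by rw [inner_compress]; rfl
  rw [h1, covOpT, LinearMap.comp_apply, apply_inverse _ (compress_pos K S hpos), LinearMap.adjoint_inner_right]
  rfl

/-- `C(Sk) = k` on `K`. [cite: Balaban1984PropagatorsII, (2.110) p.242] -/
theorem covOp_apply_app (K : Submodule ℝ V) (S : V →ₗ[ℝ] V) (hpos : ∀ k : ↥K, k ≠ 0 → 0 < ⟪(k : V), S k⟫_ℝ)
    (k : ↥K) : covOp K S (S k) = k := by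
  have h1 : LinearMap.adjoint K.subtype (S (k : V)) = compress K S k := rfl
  rw [covOp_apply, covOpT, LinearMap.comp_apply, h1, inverse_apply _ (compress_pos K S hpos)]
  rfl

/-- The covariance is positive on `K`: `⟨k, Ck⟩ > 0` for `k ∈ K ∖ 0` (*"C̃^{(j)}_Λ … bounded"*, p. 246; positivity of a covariance).
[cite: Balaban1984PropagatorsII, p.246] -/
theorem covOp_pos (K : Submodule ℝ V) (S : V →ₗ[ℝ] V) (hpos : ∀ k : ↥K, k ≠ 0 → 0 < ⟪(k : V), S k⟫_ℝ) (k : ↥K)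
    (hk : k ≠ 0) : 0 < ⟪(k : V), covOp K S k⟫_ℝ := by
  have h1 : LinearMap.adjoint K.subtype (k : V) = k := by
    apply ext_inner_left ℝ
    intro k'
    rw [LinearMap.adjoint_inner_right]
    rfl
  have h2 : ⟪(k : V), covOp K S k⟫_ℝ = ⟪k, Ring.inverse (compress K S) k⟫_ℝ := by
    rw [covOp_apply, covOpT, LinearMap.comp_apply, h1]; rfl
  rw [h2]
  exact inverse_pos _ (compress_pos K S hpos) k hk

omit [FiniteDimensional ℝ V] in
/-- **Uniqueness of the covariance** (*"a covariance"* is determined on the whole space once it ranges in `K`): two operators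
ranging in `K` and inverting a form positive definite on `K` coincide. [cite: Balaban1984PropagatorsII, (2.115) p.243 + (2.131) p.246] -/
theorem cov_unique (K : Submodule ℝ V) (S : V →ₗ[ℝ] V) (hpos : ∀ k : ↥K, k ≠ 0 → 0 < ⟪(k : V), S k⟫_ℝ)
    (T₁ T₂ : V →ₗ[ℝ] V) (h₁ : ∀ v, T₁ v ∈ K) (h₂ : ∀ v, T₂ v ∈ K)
    (hs₁ : ∀ (k : ↥K) (s : V), ⟪(k : V), S (T₁ s)⟫_ℝ = ⟪(k : V), s⟫_ℝ)
    (hs₂ : ∀ (k : ↥K) (s : V), ⟪(k : V), S (T₂ s)⟫_ℝ = ⟪(k : V), s⟫_ℝ) : T₁ = T₂ := by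
  refine LinearMap.ext fun s => ?_
  set d : ↥K := ⟨T₁ s - T₂ s, K.sub_mem (h₁ s) (h₂ s)⟩ with hd
  have h0 : ⟪(d : V), S d⟫_ℝ = 0 := by
    have : (d : V) = T₁ s - T₂ s := rfl
    rw [this, map_sub, inner_sub_right]
    change ⟪((d : ↥K) : V), S (T₁ s)⟫_ℝ - ⟪((d : ↥K) : V), S (T₂ s)⟫_ℝ = 0
    rw [hs₁, hs₂, sub_self]
  by_contra hne
  have hd0 : d ≠ 0 := fun h => hne (sub_eq_zero.mp (by simpa [hd] using congrArg Subtype.val h))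
  exact (hpos d hd0).ne' h0

end Generic

end Literature.MathematicalPhysics.QuantumFieldTheory.Balaban1983to89.B6CovarianceOperator

end
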